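/-
Copyright (c) 2026. All rights reserved.
Released under Apache 2.0 license as described in the file LICENSE.
-/
import Summits.HubbardSuperconductivity.HubbardLadder.HubbardOneBodyRows
import Summits.HubbardSuperconductivity.HubbardLadder.HubbardPairChargeCeilingRows
import Literature.MathematicalPhysics.QuantumLattice.HubbardGroundStateLatticeCovariance
import HarnessLib

/-!
# R2 rows: lattice-symmetry covariance of the half-filled `4 × 4` Hubbard ground state — per-bond hopping
# brackets and per-site pair/charge/density ceilings (device D12)

HONEST FRAMING: ladder R1–R4 with certified numbers; no claim on H/H₀.

Device D12 (`Literature/…/HubbardGroundStateLatticeCovariance`, all PROVED there; Lieb 1989 Theorem 2 +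
the Lieb–Loss–McCann remark "it is also a ground state; by uniqueness …"): every symmetry `U_π` of the
Hubbard Hamiltonian with `U_π H U_πᴴ = H` fixes the UNIQUE half-filled ground state `ψ` up to a phase, so
`⟨ψ, (U_π A U_πᴴ) ψ⟩ = ⟨ψ, A ψ⟩` for every operator `A`. On the `4 × 4` torus (`t = 1`, `N = 16`, every `U > 0`)
this file records, as plain theorems about `ψ`:

* B9.t  translation invariance of the one-body density matrix and of the density–density, on-site-pair and
  charge correlators: `⟨c†_{x+v,σ} c_{y+v,τ}⟩ = ⟨c†_{xσ} c_{yτ}⟩`, `⟨n_{x+v,σ} n_{y+v,τ}⟩ = ⟨n_{xσ} n_{yτ}⟩`,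
  `⟨Δ†_{x+v} Δ_{x+v+r}⟩ = ⟨Δ†_x Δ_{x+r}⟩`, `⟨(n_{x+v}-1)(n_{x+v+r}-1)⟩ = ⟨(n_x-1)(n_{x+r}-1)⟩`;
* B9.s  spin independence `G_↓(x,y) = G_↑(x,y)`;
* B9.b  ALL `128` nearest-neighbour (bond, spin) hopping amplitudes are equal and real, and
  `⟨ψ, H(1,0) ψ⟩ = -128 ⟨c†_{xσ} c_{yσ}⟩_{nn}` — so the bond–spin AVERAGE `ḡ` of row B8.g (LEAN REQUEST #64)
  IS the amplitude of every single bond;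
* B9.g  per-bond brackets (claim form, the nodes of B8.K): `⟨c†_{xσ} c_{yσ}⟩ ∈ [0.1718, 0.1875] (U=2),
  [0.1456, 0.1775] (U=4), [0.1178, 0.1642] (U=6), [0.0981, 0.1488] (U=8)` for EVERY nearest-neighbour pair;
* B9.P/C/N  per-site versions of the translation-averaged rows B7.P/C/N (LEAN REQUEST #60): for every site
  `x` and displacement `r`, `|⟨Δ†_x Δ_{x+r}⟩| ≤ c(U)`, and for `r ≠ 0`, `|⟨(n_x-1)(n_{x+r}-1)⟩| ≤ 2c(U)`,
  `|⟨n_x n_{x+r}⟩ - 1| ≤ 2c(U)` with `c = 0.1870 (U=2, 1 node), 0.1422 (U=4), 0.1090 (U=6), 0.0827 (U=8)`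
  (3 nodes each).

HONEST LIMITS: the covariance needs uniqueness, i.e. half filling, `U > 0`, `t' = 0`, even side; it transfers
NO new number — every bracket here is a B7/B8 bracket re-read per bond / per site (the INHERITED pub-mbboot
sector-SDP lower nodes, LEAN REQUEST #39.2, and E2 Rayleigh upper nodes, LEAN REQUEST #48, are the only
numerical inputs); no `D₄`-resolved row is recorded because at `|r| ≤ 2` on the `4 × 4` torus the
point group adds nothing to translations for these scalar correlators beyond B9.b. No held source tabulates
the `4 × 4` nearest-neighbour hopping amplitude itself; R2-TABLE.md records B9.g without a printed comparator.

## References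
* E. H. Lieb, Phys. Rev. Lett. 62 (1989) 1201, Theorem 2. [cite: LiebPRL1989, Theorem 2]
* E. H. Lieb, M. Loss, R. J. McCann, J. Math. Phys. 34 (1993) 891, p. 894. [cite: LiebLossMccann1993, p. 894]
* G. Benfatto, A. Giuliani, V. Mastropietro, Ann. Henri Poincaré 7 (2006) 809, §2.1–2.2.
  [cite: BenfattoGiulianiMastropietro2006, §2.1-2.2]
* S.-C. Zhang, Phys. Rev. Lett. 65 (1990) 120 (pseudospin `SU(2)`). [cite: Zhang1990]
* T. Koma, H. Tasaki, J. Stat. Phys. 76 (1994) 745, §1. [cite: KomaTasaki1994, §1]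
* E. Dagotto, Rev. Mod. Phys. 66 (1994) 763, §III (4 × 4 benchmarks). [cite: Dagotto1994, §III]
-/

noncomputable section

namespace Summit.HubbardSuperconductivity.HubbardLadder

open Literature.MathematicalPhysics.QuantumLattice Matrix

open Bounds

/-! ### Helpers: the `4 × 4` instance of device D12 -/

/-- `16 = 4²` particles: the D12 normalisation of the half-filled ground state. -/
private theorem gs_sq {U : ℝ} {ψ : Fock (Orb (FermionTorus 2 4))}
    (hψ : IsGroundState (hamiltonian (fermionTorusGraph 2 4) 1 U) 16 ψ) :
    IsGroundState (hamiltonian (fermionTorusGraph 2 4) 1 U) (4 ^ 2) ψ := by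
  simpa using hψ

/-- `toTorusSite` is additive on the `4 × 4` torus. -/
private theorem toTorusSite_add₄ (x v : FermionTorus 2 4) :
    FermionTorus.toTorusSite (x + v) = FermionTorus.toTorusSite x + FermionTorus.toTorusSite v := by
  funext i
  show ((ofLex (x + v) i : ℕ) : ZMod 4) = ((ofLex x i : ℕ) : ZMod 4) + ((ofLex v i : ℕ) : ZMod 4)
  rw [show (ofLex (x + v) i : ℕ) = ((ofLex x i : ℕ) + (ofLex v i : ℕ)) % 4 from Fin.val_add _ _,
    ZMod.natCast_mod, Nat.cast_add]

/-- The torus translation by `v̄` acts on native orbitals as `(x,σ) ↦ (x+v,σ)`. -/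
private theorem translate_orb₄ (v x : FermionTorus 2 4) (σ : Fin 2) :
    Orb.translate (FermionTorus.toTorusSite v) (orb x σ) = orb (x + v) σ := by
  conv_lhs => rw [← FermionTorus.ofTorusSite_toTorusSite x]
  rw [Orb.translate_orb, ← toTorusSite_add₄, FermionTorus.ofTorusSite_toTorusSite]

/-- D12 on the `4 × 4` torus: `⟨ψ, (T_v A T_vᴴ) ψ⟩ = ⟨ψ, A ψ⟩` for every operator `A` and translation `v`. -/
private theorem expect_translate₄ {U : ℝ} (hU : 0 < U) {ψ : Fock (Orb (FermionTorus 2 4))}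
    (hψ : IsGroundState (hamiltonian (fermionTorusGraph 2 4) 1 U) 16 ψ) (v : FermionTorus 2 4)
    (X : Matrix (Finset (Orb (FermionTorus 2 4))) (Finset (Orb (FermionTorus 2 4))) ℂ) :
    expect (relabel (Orb.translate (FermionTorus.toTorusSite v)) X) ψ = expect X ψ :=
  hubbardTorus_expect_relabel_translate_eq (L := 4) (by decide) one_ne_zero hU (gs_sq hψ) _ X

/-- `relabel` fixes the identity operator (derived from multiplicativity and bijectivity, so that the
statement's own `DecidableEq` instance is used). -/
private theorem relabel_one₄ (e : Equiv.Perm (Orb (FermionTorus 2 4))) :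
    relabel e (1 : Matrix (Finset (Orb (FermionTorus 2 4))) (Finset (Orb (FermionTorus 2 4))) ℂ) = 1 := by
  have h := relabel_relabel_symm e
    (1 : Matrix (Finset (Orb (FermionTorus 2 4))) (Finset (Orb (FermionTorus 2 4))) ℂ)
  calc relabel e 1 = relabel e 1 * relabel e (relabel e.symm 1) := by rw [h, mul_one]
    _ = relabel e (1 * relabel e.symm 1) := by rw [relabel_mul]
    _ = 1 := by rw [one_mul, h]

/-- `|(ℤ/4ℤ)²| = 16`. -/
private theorem card_sixteen : Fintype.card (FermionTorus 2 4) = 16 := by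
  simp only [FermionTorus, Fintype.card_lex, Fintype.card_fun, Fintype.card_fin]; norm_num

/-- A translation-invariant site function sums to `16` times any of its values. -/
private theorem sum_eq_sixteen_mul {F : FermionTorus 2 4 → ℂ} (hF : ∀ x v, F (x + v) = F x)
    (x : FermionTorus 2 4) : ∑ x' : FermionTorus 2 4, F x' = 16 * F x := by
  have h : ∀ x', F x' = F x := fun x' => by rw [← hF x (x' - x), add_sub_cancel]
  rw [Finset.sum_congr rfl fun x' _ => h x', Finset.sum_const, Finset.card_univ, card_sixteen,
    nsmul_eq_mul]
  norm_num

/-! ### Certificate-free rows (every `U > 0`): translation and spin covariance -/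

/-- **R2 row B9.t (every `U > 0`)**: the one-body density matrix of the half-filled `4 × 4` torus ground
state is translation invariant, `⟨c†_{x+v,σ} c_{y+v,τ}⟩ = ⟨c†_{xσ} c_{yτ}⟩`. [cite: LiebPRL1989, Theorem 2]
[cite: BenfattoGiulianiMastropietro2006, §2.2] -/
theorem oneBody_four_translate {U : ℝ} (hU : 0 < U) {ψ : Fock (Orb (FermionTorus 2 4))}
    (hψ : IsGroundState (hamiltonian (fermionTorusGraph 2 4) 1 U) 16 ψ)
    (v x y : FermionTorus 2 4) (σ τ : Fin 2) :
    expect (creation (orb (x + v) σ) * annihilation (orb (y + v) τ)) ψ =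
      expect (creation (orb x σ) * annihilation (orb y τ)) ψ :=
  hubbardTorus_expect_creation_mul_annihilation_translate (L := 4) (by decide) one_ne_zero hU (gs_sq hψ)
    v x y σ τ

/-- **R2 row B9.t′ (every `U > 0`)**: density–density correlators are translation invariant,
`⟨n_{x+v,σ} n_{y+v,τ}⟩ = ⟨n_{xσ} n_{yτ}⟩`. [cite: LiebPRL1989, Theorem 2] [cite: BenfattoGiulianiMastropietro2006, §2.2] -/
theorem numberCorr_four_translate {U : ℝ} (hU : 0 < U) {ψ : Fock (Orb (FermionTorus 2 4))}
    (hψ : IsGroundState (hamiltonian (fermionTorusGraph 2 4) 1 U) 16 ψ)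
    (v x y : FermionTorus 2 4) (σ τ : Fin 2) :
    expect (numberOp (x + v) σ * numberOp (y + v) τ) ψ = expect (numberOp x σ * numberOp y τ) ψ :=
  hubbardTorus_expect_numberOp_mul_numberOp_translate (L := 4) (by decide) one_ne_zero hU (gs_sq hψ)
    v x y σ τ

/-- **R2 row B9.tP (every `U > 0`)**: the on-site pair correlator is translation invariant,
`⟨c†_{x+v,↑} c†_{x+v,↓} c_{x+v+r,↓} c_{x+v+r,↑}⟩ = ⟨c†_{x↑} c†_{x↓} c_{x+r,↓} c_{x+r,↑}⟩`. [cite: LiebPRL1989, Theorem 2]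
[cite: Zhang1990] -/
theorem pairCorr_four_translate {U : ℝ} (hU : 0 < U) {ψ : Fock (Orb (FermionTorus 2 4))}
    (hψ : IsGroundState (hamiltonian (fermionTorusGraph 2 4) 1 U) 16 ψ) (x v r : FermionTorus 2 4) :
    expect (creation (orb (x + v) 0) * creation (orb (x + v) 1) *
        (annihilation (orb (x + v + r) 1) * annihilation (orb (x + v + r) 0))) ψ =
      expect (creation (orb x 0) * creation (orb x 1) *
        (annihilation (orb (x + r) 1) * annihilation (orb (x + r) 0))) ψ := by
  rw [← expect_translate₄ hU hψ v (creation (orb x 0) * creation (orb x 1) *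
    (annihilation (orb (x + r) 1) * annihilation (orb (x + r) 0))), relabel_mul, relabel_mul, relabel_mul,
    relabel_creation, relabel_creation, relabel_annihilation, relabel_annihilation, translate_orb₄,
    translate_orb₄, translate_orb₄, translate_orb₄, add_right_comm x r v]

/-- **R2 row B9.tC (every `U > 0`)**: the charge correlator is translation invariant,
`⟨(n_{x+v}-1)(n_{x+v+r}-1)⟩ = ⟨(n_x-1)(n_{x+r}-1)⟩`. [cite: LiebPRL1989, Theorem 2] [cite: Zhang1990] -/
theorem chargeCorr_four_translate {U : ℝ} (hU : 0 < U) {ψ : Fock (Orb (FermionTorus 2 4))}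
    (hψ : IsGroundState (hamiltonian (fermionTorusGraph 2 4) 1 U) 16 ψ) (x v r : FermionTorus 2 4) :
    expect ((numberOp (x + v) 0 + numberOp (x + v) 1 - 1) *
        (numberOp (x + v + r) 0 + numberOp (x + v + r) 1 - 1)) ψ =
      expect ((numberOp x 0 + numberOp x 1 - 1) * (numberOp (x + r) 0 + numberOp (x + r) 1 - 1)) ψ := by
  have hn : ∀ (y : FermionTorus 2 4) (σ : Fin 2),
      relabel (Orb.translate (FermionTorus.toTorusSite v)) (numberOp y σ) = numberOp (y + v) σ := by
    intro y σ
    rw [numberOp, numberOp, relabel_mul, relabel_creation, relabel_annihilation, translate_orb₄]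
  rw [← expect_translate₄ hU hψ v ((numberOp x 0 + numberOp x 1 - 1) *
    (numberOp (x + r) 0 + numberOp (x + r) 1 - 1)), relabel_mul, relabel_sub, relabel_sub, relabel_add,
    relabel_add, hn, hn, hn, hn, relabel_one₄, add_right_comm x r v]

/-- **R2 row B9.tN (every `U > 0`)**: the site-density correlator is translation invariant,
`⟨n_{x+v} n_{x+v+r}⟩ = ⟨n_x n_{x+r}⟩`. [cite: LiebPRL1989, Theorem 2] [cite: LiebLossMccann1993, p. 894] -/
theorem densityCorr_four_translate {U : ℝ} (hU : 0 < U) {ψ : Fock (Orb (FermionTorus 2 4))}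
    (hψ : IsGroundState (hamiltonian (fermionTorusGraph 2 4) 1 U) 16 ψ) (x v r : FermionTorus 2 4) :
    expect ((numberOp (x + v) 0 + numberOp (x + v) 1) * (numberOp (x + v + r) 0 + numberOp (x + v + r) 1)) ψ =
      expect ((numberOp x 0 + numberOp x 1) * (numberOp (x + r) 0 + numberOp (x + r) 1)) ψ := by
  have hn : ∀ (y : FermionTorus 2 4) (σ : Fin 2),
      relabel (Orb.translate (FermionTorus.toTorusSite v)) (numberOp y σ) = numberOp (y + v) σ := by
    intro y σ
    rw [numberOp, numberOp, relabel_mul, relabel_creation, relabel_annihilation, translate_orb₄]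
  rw [← expect_translate₄ hU hψ v ((numberOp x 0 + numberOp x 1) * (numberOp (x + r) 0 + numberOp (x + r) 1)),
    relabel_mul, relabel_add, relabel_add, hn, hn, hn, hn, add_right_comm x r v]

/-- **R2 row B9.s (every `U > 0`)**: `G_↓(x,y) = G_↑(x,y)`, `⟨c†_{x↓} c_{y↓}⟩ = ⟨c†_{x↑} c_{y↑}⟩`.
[cite: LiebPRL1989, Theorem 2] [cite: BenfattoGiulianiMastropietro2006, §2.1] -/
theorem oneBody_four_down_eq_up {U : ℝ} (hU : 0 < U) {ψ : Fock (Orb (FermionTorus 2 4))}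
    (hψ : IsGroundState (hamiltonian (fermionTorusGraph 2 4) 1 U) 16 ψ) (x y : FermionTorus 2 4) :
    expect (creation (orb x 1) * annihilation (orb y 1)) ψ =
      expect (creation (orb x 0) * annihilation (orb y 0)) ψ :=
  hubbardTorus_expect_creation_mul_annihilation_down_eq_up (L := 4) (by decide) one_ne_zero hU (gs_sq hψ) x y

/-! ### Certificate-free rows (every `U > 0`): all bonds are equal -/

/-- **R2 row B9.b (every `U > 0`)**: all `128` nearest-neighbour (bond, spin) hopping amplitudes of the
half-filled `4 × 4` torus ground state are equal: `⟨c†_{xσ} c_{yσ}⟩ = ⟨c†_{x'σ'} c_{y'σ'}⟩` for any two ordered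
nearest-neighbour pairs. [cite: LiebPRL1989, Theorem 2] [cite: BenfattoGiulianiMastropietro2006, §2.1-2.2] -/
theorem oneBody_four_nn_eq {U : ℝ} (hU : 0 < U) {ψ : Fock (Orb (FermionTorus 2 4))}
    (hψ : IsGroundState (hamiltonian (fermionTorusGraph 2 4) 1 U) 16 ψ)
    {x y x' y' : FermionTorus 2 4} (hxy : (fermionTorusGraph 2 4).Adj x y)
    (hx'y' : (fermionTorusGraph 2 4).Adj x' y') (σ σ' : Fin 2) :
    expect (creation (orb x σ) * annihilation (orb y σ)) ψ =
      expect (creation (orb x' σ') * annihilation (orb y' σ')) ψ :=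
  hubbardTorus_expect_creation_mul_annihilation_nn_eq (L := 4) (by decide) one_ne_zero hU (gs_sq hψ)
    hxy hx'y' σ σ'

/-- **R2 row B9.b′ (every `U > 0`)**: the kinetic energy is `128` times the bond amplitude,
`⟨ψ, H(1,0) ψ⟩ = -128 ⟨ψ, c†_{xσ} c_{yσ} ψ⟩` for every nearest-neighbour pair `(x,y)` and spin `σ`.
[cite: LiebPRL1989, Theorem 2] [cite: BenfattoGiulianiMastropietro2006, §2.1-2.2] -/
theorem kinetic_four_eq_nn {U : ℝ} (hU : 0 < U) {ψ : Fock (Orb (FermionTorus 2 4))}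
    (hψ : IsGroundState (hamiltonian (fermionTorusGraph 2 4) 1 U) 16 ψ)
    {x y : FermionTorus 2 4} (hxy : (fermionTorusGraph 2 4).Adj x y) (σ : Fin 2) :
    expect (hamiltonian (fermionTorusGraph 2 4) 1 0) ψ =
      -128 * expect (creation (orb x σ) * annihilation (orb y σ)) ψ := by
  rw [hubbardTorus_expect_hamiltonian_zero_eq_nn (L := 4) (by decide) (by norm_num) one_ne_zero hU
    (gs_sq hψ) hxy σ 1]
  push_cast
  ring

/-- **R2 row B9.b″ (every `U > 0`)**: every one-body amplitude is real, `Im ⟨c†_a c_b⟩ = 0` (device D11).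
[cite: LiebLossMccann1993, Theorem eqs. (5)-(6)] -/
theorem oneBody_four_im_eq_zero {U : ℝ} (hU : 0 < U) {ψ : Fock (Orb (FermionTorus 2 4))}
    (hψ : IsGroundState (hamiltonian (fermionTorusGraph 2 4) 1 U) 16 ψ) (a b : Orb (FermionTorus 2 4)) :
    (expect (creation a * annihilation b) ψ).im = 0 := by
  have h := (hubbardTorus_expect_creation_mul_annihilation_real_symm (L := 4) (by decide) one_ne_zero hU
    (gs_sq hψ) a b).1
  have him := congrArg Complex.im h
  rw [Complex.star_def, Complex.conj_im] at him
  linarith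

/-! ### Claim-form rows: the bracket on EVERY nearest-neighbour bond -/

/-- From a bracket on the kinetic energy per site `Re⟨H(1,0)⟩/16 ∈ [lo, hi]` to the bracket
`Re⟨c†_{xσ} c_{yσ}⟩ ∈ [-hi/8, -lo/8]` on every nearest-neighbour bond. [cite: LiebPRL1989, Theorem 2] -/
theorem nnHopping_four_mem_Icc_of_kinetic {U : ℝ} (hU : 0 < U) {ψ : Fock (Orb (FermionTorus 2 4))}
    (hψ : IsGroundState (hamiltonian (fermionTorusGraph 2 4) 1 U) 16 ψ)
    {x y : FermionTorus 2 4} (hxy : (fermionTorusGraph 2 4).Adj x y) (σ : Fin 2) {lo hi : ℝ}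
    (h : (expect (hamiltonian (fermionTorusGraph 2 4) 1 0) ψ).re / 16 ∈ Set.Icc lo hi) :
    (expect (creation (orb x σ) * annihilation (orb y σ)) ψ).re ∈ Set.Icc (-hi / 8) (-lo / 8) := by
  rw [kinetic_four_eq_nn hU hψ hxy σ] at h
  have hre : ((-128 : ℂ) * expect (creation (orb x σ) * annihilation (orb y σ)) ψ).re =
      -128 * (expect (creation (orb x σ) * annihilation (orb y σ)) ψ).re := by
    simp [Complex.mul_re]
  rw [hre] at h
  obtain ⟨h1, h2⟩ := h
  constructor <;> linarith

/-- **R2 row B9.g at `U = 2`, claim form** (nodes of B8a.K: E2 upper at `U = 2`, lower at `U = 4`): on EVERY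
nearest-neighbour bond and spin, `Re⟨c†_{xσ} c_{yσ}⟩ ∈ [0.1718, 0.1875]`. [cite: KomaTasaki1994, §1]
[cite: LiebPRL1989, Theorem 2] -/
theorem nnHopping_four_U2_mem_Icc_of_claims {ψ : Fock (Orb (FermionTorus 2 4))}
    (hψ : IsGroundState (hamiltonian (fermionTorusGraph 2 4) 1 2) 16 ψ) (hψ1 : star ψ ⬝ᵥ ψ = 1)
    (h₂ : torusUpper_mbbootE2_4x4_U2_N16) (h₄ : torusLower_mbboot_4x4_U4_N16)
    {x y : FermionTorus 2 4} (hxy : (fermionTorusGraph 2 4).Adj x y) (σ : Fin 2) :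
    (expect (creation (orb x σ) * annihilation (orb y σ)) ψ).re ∈ Set.Icc (0.1718 : ℝ) 0.1875 := by
  have h := nnHopping_four_mem_Icc_of_kinetic (by norm_num) hψ hxy σ
    (kineticPerSite_four_U2_mem_Icc_of_claims hψ hψ1 h₂ h₄)
  exact ⟨le_trans (by norm_num) h.1, le_trans h.2 (by norm_num)⟩

/-- **R2 row B9.g at `U = 4`, claim form** (nodes of B8.K: lower at `U = 2`, E2 upper at `U = 4`, lower at
`U = 6`): on every nearest-neighbour bond and spin, `Re⟨c†_{xσ} c_{yσ}⟩ ∈ [0.1456, 0.1775]`.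
[cite: KomaTasaki1994, §1] [cite: LiebPRL1989, Theorem 2] -/
theorem nnHopping_four_U4_mem_Icc_of_claims {ψ : Fock (Orb (FermionTorus 2 4))}
    (hψ : IsGroundState (hamiltonian (fermionTorusGraph 2 4) 1 4) 16 ψ) (hψ1 : star ψ ⬝ᵥ ψ = 1)
    (h₂ : torusLower_mbboot_4x4_U2_N16) (h₄ : torusUpper_mbbootE2_4x4_U4_N16)
    (h₆ : torusLower_mbboot_4x4_U6_N16)
    {x y : FermionTorus 2 4} (hxy : (fermionTorusGraph 2 4).Adj x y) (σ : Fin 2) :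
    (expect (creation (orb x σ) * annihilation (orb y σ)) ψ).re ∈ Set.Icc (0.1456 : ℝ) 0.1775 := by
  have h := nnHopping_four_mem_Icc_of_kinetic (by norm_num) hψ hxy σ
    (kineticPerSite_four_U4_mem_Icc_of_claims hψ hψ1 h₂ h₄ h₆)
  exact ⟨le_trans (by norm_num) h.1, le_trans h.2 (by norm_num)⟩

/-- **R2 row B9.g at `U = 6`, claim form** (nodes of B8b.K: lower at `U = 4`, E2 upper at `U = 6`, lower at
`U = 8`): on every nearest-neighbour bond and spin, `Re⟨c†_{xσ} c_{yσ}⟩ ∈ [0.1178, 0.1642]`.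
[cite: KomaTasaki1994, §1] [cite: LiebPRL1989, Theorem 2] -/
theorem nnHopping_four_U6_mem_Icc_of_claims {ψ : Fock (Orb (FermionTorus 2 4))}
    (hψ : IsGroundState (hamiltonian (fermionTorusGraph 2 4) 1 6) 16 ψ) (hψ1 : star ψ ⬝ᵥ ψ = 1)
    (h₄ : torusLower_mbboot_4x4_U4_N16) (h₆ : torusUpper_mbbootE2_4x4_U6_N16)
    (h₈ : torusLower_mbboot_4x4_U8_N16)
    {x y : FermionTorus 2 4} (hxy : (fermionTorusGraph 2 4).Adj x y) (σ : Fin 2) :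
    (expect (creation (orb x σ) * annihilation (orb y σ)) ψ).re ∈ Set.Icc (0.1178 : ℝ) 0.1642 := by
  have h := nnHopping_four_mem_Icc_of_kinetic (by norm_num) hψ hxy σ
    (kineticPerSite_four_U6_mem_Icc_of_claims hψ hψ1 h₄ h₆ h₈)
  exact ⟨le_trans (by norm_num) h.1, le_trans h.2 (by norm_num)⟩

/-- **R2 row B9.g at `U = 8`, claim form** (nodes of B8c.K: lower at `U = 6`, E2 upper at `U = 8`, lower at
`U = 12`): on every nearest-neighbour bond and spin, `Re⟨c†_{xσ} c_{yσ}⟩ ∈ [0.0981, 0.1488]`.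
[cite: KomaTasaki1994, §1] [cite: LiebPRL1989, Theorem 2] -/
theorem nnHopping_four_U8_mem_Icc_of_claims {ψ : Fock (Orb (FermionTorus 2 4))}
    (hψ : IsGroundState (hamiltonian (fermionTorusGraph 2 4) 1 8) 16 ψ) (hψ1 : star ψ ⬝ᵥ ψ = 1)
    (h₆ : torusLower_mbboot_4x4_U6_N16) (h₈ : torusUpper_mbbootE2_4x4_U8_N16)
    (h₁₂ : torusLower_mbboot_4x4_U12_N16)
    {x y : FermionTorus 2 4} (hxy : (fermionTorusGraph 2 4).Adj x y) (σ : Fin 2) :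
    (expect (creation (orb x σ) * annihilation (orb y σ)) ψ).re ∈ Set.Icc (0.0981 : ℝ) 0.1488 := by
  have h := nnHopping_four_mem_Icc_of_kinetic (by norm_num) hψ hxy σ
    (kineticPerSite_four_U8_mem_Icc_of_claims hψ hψ1 h₆ h₈ h₁₂)
  exact ⟨le_trans (by norm_num) h.1, le_trans h.2 (by norm_num)⟩

/-! ### Per-site ceilings on the pair, charge and density correlators (B7 rows without the `Σ_x`) -/

/-- **D10 + D12 kernel on the `4 × 4` torus**: if `⟨D̂⟩_ψ/16 ≤ c` in a half-filled unit ground state then at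
EVERY site `x`: (i) `|⟨Δ†_x Δ_{x+r}⟩| ≤ c` for every `r`, (ii) `|⟨(n_x-1)(n_{x+r}-1)⟩| ≤ 2c` and
(iii) `|⟨n_x n_{x+r}⟩ - 1| ≤ 2c` for every `r ≠ 0` (translation covariance turns the translation averages of
`HubbardPairChargeCeilingRows` into the value at each site). [cite: Zhang1990] [cite: LiebPRL1989, Theorem 2] -/
theorem pair_charge_density_site_ceilings_of_doubleOcc_le {U : ℝ} (hU : 0 < U)
    {ψ : Fock (Orb (FermionTorus 2 4))} (hψ : IsGroundState (hamiltonian (fermionTorusGraph 2 4) 1 U) 16 ψ)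
    (hψ1 : star ψ ⬝ᵥ ψ = 1) {c : ℝ}
    (hd : (expect (∑ x : FermionTorus 2 4, numberOp x 0 * numberOp x 1) ψ).re / 16 ≤ c) :
    (∀ x r : FermionTorus 2 4, ‖expect (creation (orb x 0) * creation (orb x 1) *
        (annihilation (orb (x + r) 1) * annihilation (orb (x + r) 0))) ψ‖ ≤ c) ∧
    (∀ x r : FermionTorus 2 4, r ≠ 0 →
        ‖expect ((numberOp x 0 + numberOp x 1 - 1) * (numberOp (x + r) 0 + numberOp (x + r) 1 - 1)) ψ‖ ≤ 2 * c) ∧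
    (∀ x r : FermionTorus 2 4, r ≠ 0 →
        ‖expect ((numberOp x 0 + numberOp x 1) * (numberOp (x + r) 0 + numberOp (x + r) 1)) ψ - 1‖ ≤ 2 * c) := by
  obtain ⟨hP, hC, hN⟩ := pair_charge_density_ceilings_of_doubleOcc_le hU hψ hψ1 hd
  have h16 : ‖(16 : ℂ)‖ = 16 := by simp
  refine ⟨fun x r => ?_, fun x r hr => ?_, fun x r hr => ?_⟩
  · have h := hP r
    rwa [sum_eq_sixteen_mul (fun x' v => pairCorr_four_translate hU hψ x' v r) x, norm_mul, h16,
      mul_div_cancel_left₀ _ (by norm_num : (16 : ℝ) ≠ 0)] at h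
  · have h := hC r hr
    rwa [sum_eq_sixteen_mul (fun x' v => chargeCorr_four_translate hU hψ x' v r) x, norm_mul, h16,
      mul_div_cancel_left₀ _ (by norm_num : (16 : ℝ) ≠ 0)] at h
  · have h := hN r hr
    rwa [sum_eq_sixteen_mul (fun x' v => densityCorr_four_translate hU hψ x' v r) x,
      mul_div_cancel_left₀ _ (by norm_num : (16 : ℂ) ≠ 0)] at h

/-- **R2 rows B9.P/C/N at `U = 2`, claim form** (1 node: E2 upper at `U = 2`; `c = 0.1870`): at every site `x`,
`|⟨Δ†_x Δ_{x+r}⟩| ≤ 0.1870` for every `r`, and `|⟨(n_x-1)(n_{x+r}-1)⟩| ≤ 0.3740`, `|⟨n_x n_{x+r}⟩ - 1| ≤ 0.3740`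
for every `r ≠ 0`. [cite: Zhang1990] [cite: KomaTasaki1994, §1] -/
theorem siteCorr_four_U2_of_claim {ψ : Fock (Orb (FermionTorus 2 4))}
    (hψ : IsGroundState (hamiltonian (fermionTorusGraph 2 4) 1 2) 16 ψ) (hψ1 : star ψ ⬝ᵥ ψ = 1)
    (h₂ : torusUpper_mbbootE2_4x4_U2_N16) :
    (∀ x r : FermionTorus 2 4, ‖expect (creation (orb x 0) * creation (orb x 1) *
        (annihilation (orb (x + r) 1) * annihilation (orb (x + r) 0))) ψ‖ ≤ (0.1870 : ℝ)) ∧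
    (∀ x r : FermionTorus 2 4, r ≠ 0 →
        ‖expect ((numberOp x 0 + numberOp x 1 - 1) * (numberOp (x + r) 0 + numberOp (x + r) 1 - 1)) ψ‖ ≤
          (0.3740 : ℝ)) ∧
    (∀ x r : FermionTorus 2 4, r ≠ 0 →
        ‖expect ((numberOp x 0 + numberOp x 1) * (numberOp (x + r) 0 + numberOp (x + r) 1)) ψ - 1‖ ≤
          (0.3740 : ℝ)) := by
  obtain ⟨hP, hC, hN⟩ := pair_charge_density_site_ceilings_of_doubleOcc_le (by norm_num) hψ hψ1
    (doubleOcc_four_U2_mem_Icc_of_claim hψ hψ1 h₂).2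
  exact ⟨hP, fun x r hr => (hC x r hr).trans (by norm_num), fun x r hr => (hN x r hr).trans (by norm_num)⟩

/-- **R2 rows B9.P/C/N at `U = 4`, claim form** (3 nodes: lower at `U = 2`, E2 upper at `U = 4`, lower at
`U = 6`; `c = 0.1422`): at every site, `|⟨Δ†_x Δ_{x+r}⟩| ≤ 0.1422` (all `r`), `|⟨(n_x-1)(n_{x+r}-1)⟩| ≤ 0.2844`
and `|⟨n_x n_{x+r}⟩ - 1| ≤ 0.2844` (`r ≠ 0`). [cite: Zhang1990] [cite: KomaTasaki1994, §1] -/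
theorem siteCorr_four_U4_of_claims {ψ : Fock (Orb (FermionTorus 2 4))}
    (hψ : IsGroundState (hamiltonian (fermionTorusGraph 2 4) 1 4) 16 ψ) (hψ1 : star ψ ⬝ᵥ ψ = 1)
    (h₂ : torusLower_mbboot_4x4_U2_N16) (h₄ : torusUpper_mbbootE2_4x4_U4_N16)
    (h₆ : torusLower_mbboot_4x4_U6_N16) :
    (∀ x r : FermionTorus 2 4, ‖expect (creation (orb x 0) * creation (orb x 1) *
        (annihilation (orb (x + r) 1) * annihilation (orb (x + r) 0))) ψ‖ ≤ (0.1422 : ℝ)) ∧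
    (∀ x r : FermionTorus 2 4, r ≠ 0 →
        ‖expect ((numberOp x 0 + numberOp x 1 - 1) * (numberOp (x + r) 0 + numberOp (x + r) 1 - 1)) ψ‖ ≤
          (0.2844 : ℝ)) ∧
    (∀ x r : FermionTorus 2 4, r ≠ 0 →
        ‖expect ((numberOp x 0 + numberOp x 1) * (numberOp (x + r) 0 + numberOp (x + r) 1)) ψ - 1‖ ≤
          (0.2844 : ℝ)) := by
  obtain ⟨hP, hC, hN⟩ := pair_charge_density_site_ceilings_of_doubleOcc_le (by norm_num) hψ hψ1
    (doubleOcc_four_U4_mem_Icc_of_claims hψ hψ1 h₂ h₄ h₆).2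
  exact ⟨hP, fun x r hr => (hC x r hr).trans (by norm_num), fun x r hr => (hN x r hr).trans (by norm_num)⟩

/-- **R2 rows B9.P/C/N at `U = 6`, claim form** (3 nodes: lower at `U = 4`, E2 upper at `U = 6`, lower at
`U = 8`; `c = 0.1090`): at every site, `|⟨Δ†_x Δ_{x+r}⟩| ≤ 0.1090` (all `r`), `|⟨(n_x-1)(n_{x+r}-1)⟩| ≤ 0.2180`
and `|⟨n_x n_{x+r}⟩ - 1| ≤ 0.2180` (`r ≠ 0`). [cite: Zhang1990] [cite: KomaTasaki1994, §1] -/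
theorem siteCorr_four_U6_of_claims {ψ : Fock (Orb (FermionTorus 2 4))}
    (hψ : IsGroundState (hamiltonian (fermionTorusGraph 2 4) 1 6) 16 ψ) (hψ1 : star ψ ⬝ᵥ ψ = 1)
    (h₄ : torusLower_mbboot_4x4_U4_N16) (h₆ : torusUpper_mbbootE2_4x4_U6_N16)
    (h₈ : torusLower_mbboot_4x4_U8_N16) :
    (∀ x r : FermionTorus 2 4, ‖expect (creation (orb x 0) * creation (orb x 1) *
        (annihilation (orb (x + r) 1) * annihilation (orb (x + r) 0))) ψ‖ ≤ (0.1090 : ℝ)) ∧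
    (∀ x r : FermionTorus 2 4, r ≠ 0 →
        ‖expect ((numberOp x 0 + numberOp x 1 - 1) * (numberOp (x + r) 0 + numberOp (x + r) 1 - 1)) ψ‖ ≤
          (0.2180 : ℝ)) ∧
    (∀ x r : FermionTorus 2 4, r ≠ 0 →
        ‖expect ((numberOp x 0 + numberOp x 1) * (numberOp (x + r) 0 + numberOp (x + r) 1)) ψ - 1‖ ≤
          (0.2180 : ℝ)) := by
  obtain ⟨hP, hC, hN⟩ := pair_charge_density_site_ceilings_of_doubleOcc_le (by norm_num) hψ hψ1
    (doubleOcc_four_U6_mem_Icc_of_claims hψ hψ1 h₄ h₆ h₈).2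
  exact ⟨hP, fun x r hr => (hC x r hr).trans (by norm_num), fun x r hr => (hN x r hr).trans (by norm_num)⟩

/-- **R2 rows B9.P/C/N at `U = 8`, claim form** (3 nodes: lower at `U = 6`, E2 upper at `U = 8`, lower at
`U = 12`; `c = 0.0827`): at every site, `|⟨Δ†_x Δ_{x+r}⟩| ≤ 0.0827` (all `r`), `|⟨(n_x-1)(n_{x+r}-1)⟩| ≤ 0.1654`
and `|⟨n_x n_{x+r}⟩ - 1| ≤ 0.1654` (`r ≠ 0`). [cite: Zhang1990] [cite: KomaTasaki1994, §1] -/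
theorem siteCorr_four_U8_of_claims {ψ : Fock (Orb (FermionTorus 2 4))}
    (hψ : IsGroundState (hamiltonian (fermionTorusGraph 2 4) 1 8) 16 ψ) (hψ1 : star ψ ⬝ᵥ ψ = 1)
    (h₆ : torusLower_mbboot_4x4_U6_N16) (h₈ : torusUpper_mbbootE2_4x4_U8_N16)
    (h₁₂ : torusLower_mbboot_4x4_U12_N16) :
    (∀ x r : FermionTorus 2 4, ‖expect (creation (orb x 0) * creation (orb x 1) *
        (annihilation (orb (x + r) 1) * annihilation (orb (x + r) 0))) ψ‖ ≤ (0.0827 : ℝ)) ∧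
    (∀ x r : FermionTorus 2 4, r ≠ 0 →
        ‖expect ((numberOp x 0 + numberOp x 1 - 1) * (numberOp (x + r) 0 + numberOp (x + r) 1 - 1)) ψ‖ ≤
          (0.1654 : ℝ)) ∧
    (∀ x r : FermionTorus 2 4, r ≠ 0 →
        ‖expect ((numberOp x 0 + numberOp x 1) * (numberOp (x + r) 0 + numberOp (x + r) 1)) ψ - 1‖ ≤
          (0.1654 : ℝ)) := by
  obtain ⟨hP, hC, hN⟩ := pair_charge_density_site_ceilings_of_doubleOcc_le (by norm_num) hψ hψ1
    (doubleOcc_four_U8_mem_Icc_of_claims hψ hψ1 h₆ h₈ h₁₂).2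
  exact ⟨hP, fun x r hr => (hC x r hr).trans (by norm_num), fun x r hr => (hN x r hr).trans (by norm_num)⟩

end Summit.HubbardSuperconductivity.HubbardLadder
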